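import Summits.CriticalPhenomena.CardyFormulaZ2.Theorems.CardyBoundaryCoulombGasHalfPlaneMarkDensityLawNoFreeConstant
import Summits.CriticalPhenomena.CardyFormulaZ2.Theorems.CardyBoundaryCoulombGasHalfPlaneMarkDensityLawIdentification

/-!
# Lead's skeleton (c12-0), cycle 7: **THE CRUX ⟺ PROPORTIONALITY TO CARDY IN THE FOURTH MARK**
# (crux `HalfPlaneMarkDensityLaw`, line `Sketch`)

Generalising c6-0's `NoFreeConstant` (the CONSTANT of the density law is forced by self-duality): not only the
constant but the whole dependence on the first three marks is forced by the lattice symmetries.  For a joint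
subsequential limit `G` of `P_n(a,b,c,y)` along a strictly increasing `θ`:
* P1 — if `y ↦ G(a,b,c,y)` is PROPORTIONAL to `y ↦ F(η(a,b,c,y))` for every `a < b < c`, the factor depends on the
  gap `c − b` only and continuously (reflection `G(−y,−c,−b,−a) = G(a,b,c,y)` + translation invariance + joint
  continuity; `F∘η > 0` on the chamber): `G = m(c−b)·F∘η`;
* P2 — then the wired three-mark kernel tends along `θ` to `m(σ)·F(x/(x+σ))` (the sandwich of `…WiredCardy`, as in
  `NoFreeConstant.tendsto_wired_subseq`, with the continuity of `m` absorbing the `±1/M` change of the gap);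
* P3 — c3-0's duality–reflection law on the diagonal (`SelfDual.selfDual_diagonal`: `P_n(σ,σ) → 1/2`) and
  `F(1/2) = 1/2` force `m ≡ 1`;
* hence (assembly) **`HalfPlaneMarkDensityLaw ⟺ ∀ θ G, y ↦ G(a,b,c,y) ∝ F(η(a,b,c,y))`**, and, integrating the
  density (P5, `…DensityIntegral`), **`⟺ ∀ θ G, x ↦ ∂₄G(a,b,c,x)·((x−a)(x−b)(x−c))^{2/3}` is constant** — the crux is
  exactly the `x`-SHAPE of the subsequential mark densities; normalisation and `(a,b,c)`-dependence are free.
-/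

noncomputable section

namespace Summit.CriticalPhenomena.CardyFormulaZ2.Cruxes.HalfPlaneMarkDensityLaw.SketchLine

open Literature.Probability.Percolation Literature.Probability.LatticeModels
open Literature.Probability.RandomPlanarGeometry (crossRatio)
open MeasureTheory Filter Set
open scoped Topology
open Summit.CriticalPhenomena.CardyFormulaZ2.Theorems.HalfPlaneMarkDensityLaw.Negative

namespace Proportional

/-- STUB P1: proportionality in the fourth mark forces a factor depending on the gap `c − b` only, continuously. [folklore] -/
theorem stub_prop_gapFunction :
    ∀ {θ : ℕ → ℕ} {G : ℝ → ℝ → ℝ → ℝ → ℝ},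
      (∀ a b c y : ℝ, a < b → b < c → c < y →
        Tendsto (fun n ↦ μ.real (openCrossing halfPlane (arcA a b (θ n))
          (rowIcc ⌊c * (θ n : ℕ)⌋ ⌊y * (θ n : ℕ)⌋))) atTop (𝓝 (G a b c y))) →
      StrictMono θ → (∀ a b c : ℝ, a < b → b < c → ∃ m : ℝ, ∀ y : ℝ, c < y → G a b c y = m * Literature.Probability.RandomPlanarGeometry.cardyFunction (crossRatio ![a, b, c, y])) →
      ∃ mfun : ℝ → ℝ, ContinuousOn mfun (Set.Ioi 0) ∧
        (∀ a b c y : ℝ, a < b → b < c → c < y → G a b c y = mfun (c - b) * Literature.Probability.RandomPlanarGeometry.cardyFunction (crossRatio ![a, b, c, y])) := by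
  sorry

/-- STUB P2: then the wired three-mark kernel tends along `θ` to `m(σ)·F(x/(x+σ))`. [folklore] -/
theorem stub_prop_wired :
    ∀ {θ : ℕ → ℕ} {G : ℝ → ℝ → ℝ → ℝ → ℝ},
      (∀ a b c y : ℝ, a < b → b < c → c < y →
        Tendsto (fun n ↦ μ.real (openCrossing halfPlane (arcA a b (θ n))
          (rowIcc ⌊c * (θ n : ℕ)⌋ ⌊y * (θ n : ℕ)⌋))) atTop (𝓝 (G a b c y))) →
      StrictMono θ → ∀ (mfun : ℝ → ℝ), ContinuousOn mfun (Set.Ioi 0) →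
      (∀ a b c y : ℝ, a < b → b < c → c < y → G a b c y = mfun (c - b) * Literature.Probability.RandomPlanarGeometry.cardyFunction (crossRatio ![a, b, c, y])) →
      (∀ σ x : ℝ, 0 < σ → 0 < x →
        Tendsto (fun n ↦ μ.real (openCrossing halfPlane {v : Site 2 | v 1 = 0 ∧ v 0 ≤ -⌊σ * (θ n : ℕ)⌋}
          {v : Site 2 | v 1 = 0 ∧ 1 ≤ v 0 ∧ v 0 ≤ ⌊x * (θ n : ℕ)⌋})) atTop (𝓝 (mfun σ * Literature.Probability.RandomPlanarGeometry.cardyFunction (x / (x + σ))))) := by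
  sorry

/-- STUB P3: the duality–reflection law on the diagonal forces `m ≡ 1`. [folklore] -/
theorem stub_prop_selfDual :
    ∀ {θ : ℕ → ℕ}, StrictMono θ → ∀ (mfun : ℝ → ℝ),
      (∀ σ x : ℝ, 0 < σ → 0 < x →
        Tendsto (fun n ↦ μ.real (openCrossing halfPlane {v : Site 2 | v 1 = 0 ∧ v 0 ≤ -⌊σ * (θ n : ℕ)⌋}
          {v : Site 2 | v 1 = 0 ∧ 1 ≤ v 0 ∧ v 0 ≤ ⌊x * (θ n : ℕ)⌋})) atTop (𝓝 (mfun σ * Literature.Probability.RandomPlanarGeometry.cardyFunction (x / (x + σ))))) →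
      ∀ σ : ℝ, 0 < σ → mfun σ = 1 := by
  sorry

/-- STUB P5: the `x`-shape of the density (`∂₄G·((x−a)(x−b)(x−c))^{2/3}` constant in `x`) gives proportionality to `F∘η` (integration from the closing gap `y ↓ c`, where both sides vanish). [folklore] -/
theorem stub_shape_prop :
    ∀ {θ : ℕ → ℕ} {G : ℝ → ℝ → ℝ → ℝ → ℝ},
      (∀ a b c y : ℝ, a < b → b < c → c < y →
        Tendsto (fun n ↦ μ.real (openCrossing halfPlane (arcA a b (θ n))
          (rowIcc ⌊c * (θ n : ℕ)⌋ ⌊y * (θ n : ℕ)⌋))) atTop (𝓝 (G a b c y))) →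
      StrictMono θ → (∀ a b c : ℝ, a < b → b < c → ∃ K : ℝ, ∀ x : ℝ, c < x → deriv (G a b c) x * ((x - a) * (x - b) * (x - c)) ^ ((2 : ℝ) / 3) = K) →
      (∀ a b c : ℝ, a < b → b < c → ∃ m : ℝ, ∀ y : ℝ, c < y → G a b c y = m * Literature.Probability.RandomPlanarGeometry.cardyFunction (crossRatio ![a, b, c, y])) := by
  sorry

end Proportional

end Summit.CriticalPhenomena.CardyFormulaZ2.Cruxes.HalfPlaneMarkDensityLaw.SketchLine
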